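import Summits.Ventures.HodgeRepro.FaceLatticeCore

/-!
# Engine check of Lemma L: an index-one certificate for the pair-and-face lattice, `decide`d for `m ≤ 8`

Blind re-derivation cell `pub-hodge-repro`, seat `night-3`.  Mathlib + typer-2's `FaceLatticeCore` only.
Namespace `HodgeRepro.Night3.Engine`.

The lead's Lemma L (route/lattice-lead-g18/LEMMA-L-P-v2.md) came with a COMPUTATION: the Smith normal form of the
pair-and-face generator matrix has index `[Z : L] = 1` for `m = 3, 4, 5, 6` (smith2.py / census_faces.py).  typer-2's
`FaceLattice.span_pairs_faces_eq_zeroSum` is the `m`-uniform theorem.  This file is the KERNEL ANALOGUE of the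
computation, extended to `m ≤ 8`: a finite CERTIFICATE of `[Z : L] = 1` that the kernel verifies by `decide`.

* The certificate (`cert n`, `m = n + 1`): a list of generators with PIVOTS — the squares `sq T l k` of the half-cube
  `T 0 = true` with pivot `T` (`l`, `k` = two places where `T` is `true`, listed by increasing number of `true`
  places), then the pairs `pairVec T` of the other half-cube with pivot `T`.  A square is a face modulo two pairs
  (`FaceLatticeCore.sq_eq`), so every generator lies in `L = span ℤ (pairs ∪ faces)`.
* The CHECK (`certB`): every square has `l ≠ k`; the system is UNITRIANGULAR — each generator is `1` at its pivot and
  `0` at every LATER pivot (`unitriB`); every type outside the pivot set is LOW — `T 0 = true` with at most one further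
  `true` place (`lowB`).
* SOUNDNESS, for every `n` (`span_eq_zeroSum_of_certB`): if `certB (cert n) = true` then
  `span ℤ (pairs (n+1) ∪ faces (n+1)) = zeroSum (n+1)`.  Proof: back-substitution along the unitriangular system
  (`exists_sub_mem_span_of_unitri`) clears every pivot coordinate of a zero-sum `x` by a combination of generators,
  leaving a zero-sum combination supported on the `m` LOW types, which vanishes (`eq_zero_of_low`: the weights at the
  places `j ≠ 0` read `2 x(T_j)` and the weight at `0` reads the total mass) — the rank `2^m − m` of Lemma L, made explicit.
* THE ENGINE: `certB (cert n) = true` by `decide` for `n = 0, …, 7` (`m = 1, …, 8`), hence Lemma L at `m ≤ 8` by a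
  SECOND, independent route (`index_one_le_eight`) — the lead's table `m = 3 … 6` re-verified in the kernel and extended to
  `m = 7, 8` (pairs / census faces 64 / 672 and 128 / 1792; rank `2^m − m` = 121 and 248).

Nothing here is a sealed-statement proof; the file touches no sealed file and no Tier-2 item depends on it.
-/

set_option autoImplicit false

namespace HodgeRepro.Night3.Engine

open Finset
open HodgeRepro.FaceLattice

/-! ### A. Unitriangular systems: the generic back-substitution lemma -/

section Generic

variable {ι : Type*} [DecidableEq ι] [Fintype ι]

/-- A list of (pivot, generator) pairs is UNITRIANGULAR: each generator is `1` at its pivot and `0` at every later pivot. -/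
def Unitri : List (ι × (ι → ℤ)) → Prop
  | [] => True
  | (p, g) :: L => g p = 1 ∧ (∀ q ∈ L.map Prod.fst, g q = 0) ∧ Unitri L

/-- The Boolean check of `Unitri`. -/
def unitriB : List (ι × (ι → ℤ)) → Bool
  | [] => true
  | (p, g) :: L => (g p == 1) && L.all (fun pq => g pq.1 == 0) && unitriB L

omit [DecidableEq ι] [Fintype ι] in
/-- `unitriB` decides `Unitri`. -/
theorem unitri_of_unitriB : ∀ L : List (ι × (ι → ℤ)), unitriB L = true → Unitri L
  | [], _ => trivial
  | (p, g) :: L, h => by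
    simp only [unitriB, Bool.and_eq_true, beq_iff_eq, List.all_eq_true] at h
    obtain ⟨⟨h1, h2⟩, h3⟩ := h
    refine ⟨h1, ?_, unitri_of_unitriB L h3⟩
    intro q hq
    obtain ⟨pq, hpq, rfl⟩ := List.mem_map.1 hq
    exact h2 pq hpq

omit [DecidableEq ι] [Fintype ι] in
/-- Back-substitution: for a unitriangular list `L`, every `x` differs from an element of the span of the generators
by a vector vanishing at every pivot. -/
theorem exists_sub_mem_span_of_unitri : ∀ (L : List (ι × (ι → ℤ))), Unitri L → ∀ x : ι → ℤ,
    ∃ y ∈ Submodule.span ℤ {g | g ∈ L.map Prod.snd}, ∀ q ∈ L.map Prod.fst, (x - y) q = 0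
  | [], _, x => ⟨0, Submodule.zero_mem _, fun q hq => by simp at hq⟩
  | (p, g) :: L, ⟨h1, h2, h3⟩, x => by
    obtain ⟨y', hy', hq'⟩ := exists_sub_mem_span_of_unitri L h3 x
    refine ⟨y' + (x - y') p • g, ?_, ?_⟩
    · refine Submodule.add_mem _ (Submodule.span_mono ?_ hy') (Submodule.smul_mem _ _ (Submodule.subset_span ?_))
      · intro v hv
        simp only [Set.mem_setOf_eq, List.map_cons, List.mem_cons] at hv ⊢
        exact Or.inr hv
      · simp
    · intro q hq
      simp only [List.map_cons, List.mem_cons] at hq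
      rcases hq with rfl | hq
      · simp only [Pi.sub_apply, Pi.add_apply, Pi.smul_apply, smul_eq_mul, h1, mul_one]
        ring
      · have := hq' q hq
        simp only [Pi.sub_apply] at this
        simp only [Pi.sub_apply, Pi.add_apply, Pi.smul_apply, smul_eq_mul, h2 q hq, mul_zero, add_zero]
        exact this

omit [DecidableEq ι] [Fintype ι] in
/-- The kernel of a linear map is spanned by a unitriangular family of kernel vectors when the map is injective on the
vectors supported off the pivots. -/
theorem mem_span_of_unitri {V : Type*} [AddCommGroup V] [Module ℤ V] (W : (ι → ℤ) →ₗ[ℤ] V)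
    (L : List (ι × (ι → ℤ))) (hL : Unitri L) (hker : ∀ g ∈ L.map Prod.snd, W g = 0)
    (hinj : ∀ z : ι → ℤ, (∀ q ∈ L.map Prod.fst, z q = 0) → W z = 0 → z = 0)
    {x : ι → ℤ} (hx : W x = 0) : x ∈ Submodule.span ℤ {g | g ∈ L.map Prod.snd} := by
  obtain ⟨y, hy, hq⟩ := exists_sub_mem_span_of_unitri L hL x
  have hWy : W y = 0 := by
    refine Submodule.span_induction (p := fun v _ => W v = 0) ?_ ?_ ?_ ?_ hy
    · intro g hg; exact hker g hg
    · exact map_zero W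
    · intro a b _ _ ha hb; rw [map_add, ha, hb, add_zero]
    · intro c a _ ha; rw [LinearMap.map_smul, ha, smul_zero]
  have : x - y = 0 := hinj _ hq (by rw [map_sub, hx, hWy, sub_zero])
  rw [sub_eq_zero] at this
  rw [this]; exact hy

end Generic

/-! ### B. The certificate for the pair-and-face lattice (`m = n + 1` places) -/

variable {n : ℕ}

/-- The generators of the certificate: a pair with pivot `T`, or a square `sq T l k` with pivot `T`. -/
inductive Gen (n : ℕ)
  /-- the pair `pairVec T`, pivot `T` -/
  | pair (T : CMType (n + 1)) : Gen n
  /-- the square `sq T l k`, pivot `T` -/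
  | square (T : CMType (n + 1)) (l k : Fin (n + 1)) : Gen n

/-- The pivot of a generator. -/
def Gen.pivot : Gen n → CMType (n + 1)
  | .pair T => T
  | .square T _ _ => T

/-- The vector of a generator. -/
def Gen.vec : Gen n → (CMType (n + 1) → ℤ)
  | .pair T => pairVec T
  | .square T l k => sq T l k

/-- A generator is WELL-FORMED when its square has two distinct places. -/
def Gen.ok : Gen n → Bool
  | .pair _ => true
  | .square _ l k => decide (l ≠ k)

/-- Every well-formed generator lies in the span of pairs and faces. -/
theorem Gen.vec_mem_span (g : Gen n) (h : g.ok = true) : g.vec ∈ Submodule.span ℤ (pairs (n + 1) ∪ faces (n + 1)) := by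
  cases g with
  | pair T => exact Submodule.subset_span (Or.inl ⟨T, rfl⟩)
  | square T l k =>
    simp only [Gen.ok, decide_eq_true_eq] at h
    exact sq_mem_span T h

/-- All types of `n + 1` places, as a list (binary counting on `Fin.cons`). -/
def allTypes : (m : ℕ) → List (CMType m)
  | 0 => [fun i => Fin.elim0 i]
  | m + 1 => (allTypes m).flatMap fun T => [Fin.cons true T, Fin.cons false T]

/-- Every type is listed. -/
theorem mem_allTypes : ∀ (m : ℕ) (T : CMType m), T ∈ allTypes m
  | 0, T => by
    simp only [allTypes, List.mem_singleton]
    funext i; exact Fin.elim0 i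
  | m + 1, T => by
    simp only [allTypes, List.mem_flatMap, List.mem_cons, List.not_mem_nil, or_false]
    refine ⟨Fin.tail T, mem_allTypes m _, ?_⟩
    cases h : T 0
    · right; rw [← h]; exact (Fin.cons_self_tail T).symm
    · left; rw [← h]; exact (Fin.cons_self_tail T).symm

/-- The places `i ≠ 0` where `T` is `true`, as a list. -/
def trueTail (T : CMType (n + 1)) : List (Fin (n + 1)) := (List.finRange (n + 1)).filter fun i => i ≠ 0 ∧ T i = true

/-- The number of places `i ≠ 0` where `T` is `true`. -/
def wt (T : CMType (n + 1)) : ℕ := (trueTail T).length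

/-- The square generator of a half-cube type with at least two `true` places `≠ 0` (the first two such places). -/
def squareGen (T : CMType (n + 1)) : List (Gen n) :=
  match trueTail T with
  | l :: k :: _ => [Gen.square T l k]
  | _ => []

/-- The certificate: the squares of the half-cube `T 0 = true`, by increasing `wt`, then the pairs of the other half-cube. -/
def cert (n : ℕ) : List (Gen n) :=
  ((List.range (n + 2)).flatMap fun w =>
    ((allTypes (n + 1)).filter fun T => T 0 = true ∧ wt T = w).flatMap squareGen) ++
  ((allTypes (n + 1)).filter fun T => T 0 = false).map Gen.pair

/-- `T` is LOW: `T 0 = true` and at most one further `true` place. -/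
def lowB (T : CMType (n + 1)) : Bool := T 0 && decide (wt T ≤ 1)

/-- The full check: well-formed generators, a unitriangular system, and every non-pivot type low. -/
def certB (L : List (Gen n)) : Bool :=
  L.all Gen.ok && unitriB (L.map fun g => (g.pivot, g.vec)) &&
    (allTypes (n + 1)).all fun T => decide (T ∈ L.map Gen.pivot) || lowB T

/-! ### C. Soundness: a passing certificate proves Lemma L for that `m` -/

/-- The types `T_0` (only the place `0`) and `T_j` (the places `0` and `j`). -/
def lowType (j : Fin (n + 1)) : CMType (n + 1) := fun i => decide (i = 0 ∨ i = j)

/-- A low type is `T_0` or some `T_j`, `j ≠ 0`. -/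
theorem eq_lowType_of_lowB {T : CMType (n + 1)} (h : lowB T = true) : T = lowType 0 ∨ ∃ j, j ≠ 0 ∧ T = lowType j := by
  simp only [lowB, Bool.and_eq_true, decide_eq_true_eq] at h
  obtain ⟨h0, h1⟩ := h
  have hmem : ∀ i, i ∈ trueTail T ↔ i ≠ 0 ∧ T i = true := fun i => by
    simp [trueTail, List.mem_filter, List.mem_finRange]
  rcases hT : trueTail T with _ | ⟨j, rest⟩
  · left
    funext i
    by_cases hi : i = 0
    · subst hi; simp [lowType, h0]
    · have : T i = false := by
        by_contra hc
        have := (hmem i).2 ⟨hi, by simpa using hc⟩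
        rw [hT] at this; simp at this
      simp [lowType, hi, this]
  · right
    have hrest : rest = [] := by
      have : (trueTail T).length ≤ 1 := h1
      rw [hT] at this
      simp only [List.length_cons] at this
      exact List.length_eq_zero_iff.1 (by omega)
    subst hrest
    have hj := (hmem j).1 (by rw [hT]; simp)
    refine ⟨j, hj.1, ?_⟩
    funext i
    by_cases hi : i = 0
    · subst hi; simp [lowType, h0]
    · by_cases hij : i = j
      · subst hij; simp [lowType, hj.2]
      · have : T i = false := by
          by_contra hc
          have := (hmem i).2 ⟨hi, by simpa using hc⟩
          rw [hT] at this; simp [hij] at this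
        simp [lowType, hi, hij, this]

/-- `lowType j` at a place. -/
theorem lowType_apply (j i : Fin (n + 1)) : lowType j i = decide (i = 0 ∨ i = j) := rfl

/-- The weight at a place `j ≠ 0` of a combination supported on low types: `2 x (T_j)` minus the total mass. -/
theorem weight_eq_of_low {x : CMType (n + 1) → ℤ} (hx : ∀ T, x T ≠ 0 → lowB T = true) {j : Fin (n + 1)} (hj : j ≠ 0) :
    weight j x = x (lowType j) * 2 - ∑ T, x T := by
  have key : ∀ T, x T * sgn (T j) = (if T = lowType j then x T * 2 else 0) - x T := by
    intro T
    by_cases hT : x T = 0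
    · simp [hT]
    · rcases eq_lowType_of_lowB (hx T hT) with rfl | ⟨k, hk, rfl⟩
      · have h1 : lowType 0 j = false := by simp [lowType_apply, hj]
        have h2 : lowType (0 : Fin (n + 1)) ≠ lowType j := fun h => by
          have := congrFun h j; simp [lowType_apply, hj] at this
        rw [if_neg h2, h1]; simp [sgn]
      · by_cases hkj : k = j
        · subst hkj
          have h1 : lowType k k = true := by simp [lowType_apply]
          rw [if_pos rfl, h1]; simp only [sgn, if_true]; ring
        · have h1 : lowType k j = false := by simp [lowType_apply, hj, Ne.symm hkj]
          have h2 : lowType k ≠ lowType j := fun h => by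
            have := congrFun h j; simp [lowType_apply, hj, Ne.symm hkj] at this
          rw [if_neg h2, h1]; simp [sgn]
  rw [weight_apply, Finset.sum_congr rfl fun T _ => key T, Finset.sum_sub_distrib,
    Finset.sum_eq_single (lowType j) (fun T _ hT => by simp [hT]) (by simp)]
  simp

/-- The weight at the place `0` of a combination supported on low types is its total mass. -/
theorem weight_zero_eq_of_low {x : CMType (n + 1) → ℤ} (hx : ∀ T, x T ≠ 0 → lowB T = true) :
    weight 0 x = ∑ T, x T := by
  rw [weight_apply]
  refine Finset.sum_congr rfl fun T _ => ?_
  by_cases hT : x T = 0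
  · simp [hT]
  · have h0 : T 0 = true := by
      have := hx T hT
      simp only [lowB, Bool.and_eq_true] at this
      exact this.1
    simp [h0, sgn]

/-- A zero-sum combination supported on low types vanishes (the rank `2^m − m`, made explicit). -/
theorem eq_zero_of_low {x : CMType (n + 1) → ℤ} (hx : ∀ T, x T ≠ 0 → lowB T = true) (hz : x ∈ zeroSum (n + 1)) :
    x = 0 := by
  rw [mem_zeroSum] at hz
  have hS : ∑ T, x T = 0 := by rw [← weight_zero_eq_of_low hx]; exact hz 0
  have hj : ∀ j : Fin (n + 1), j ≠ 0 → x (lowType j) = 0 := fun j hj => by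
    have := hz j
    rw [weight_eq_of_low hx hj, hS, sub_zero] at this
    omega
  have h0 : x (lowType 0) = 0 := by
    have := hS
    rw [Finset.sum_eq_single (lowType 0) (fun T _ hT => ?_) (by simp)] at this
    · exact this
    · by_cases hxT : x T = 0
      · exact hxT
      · rcases eq_lowType_of_lowB (hx T hxT) with rfl | ⟨k, hk, rfl⟩
        · exact absurd rfl hT
        · exact hj k hk
  funext T
  by_cases hxT : x T = 0
  · exact hxT
  · rcases eq_lowType_of_lowB (hx T hxT) with rfl | ⟨k, hk, rfl⟩
    · exact h0
    · exact hj k hk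

/-- Every generator of the certificate is zero-sum (a pair, or a square = a face modulo two pairs). -/
theorem Gen.vec_mem_zeroSum (g : Gen n) (h : g.ok = true) : g.vec ∈ zeroSum (n + 1) :=
  span_le (g.vec_mem_span h)

/-- **Soundness of the certificate**: a passing check proves Lemma L for `m = n + 1`. -/
theorem span_eq_zeroSum_of_certB (L : List (Gen n)) (hL : certB L = true) :
    Submodule.span ℤ (pairs (n + 1) ∪ faces (n + 1)) = zeroSum (n + 1) := by
  simp only [certB, Bool.and_eq_true, List.all_eq_true, Bool.or_eq_true, decide_eq_true_eq] at hL
  obtain ⟨⟨hok, huni⟩, hlow⟩ := hL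
  refine le_antisymm span_le fun x hx => ?_
  -- the weight map, packaged as one linear map into `Fin (n+1) → ℤ`
  let W : (CMType (n + 1) → ℤ) →ₗ[ℤ] (Fin (n + 1) → ℤ) := LinearMap.pi fun i => weight i
  have hW : ∀ z, W z = 0 ↔ z ∈ zeroSum (n + 1) := fun z => by
    rw [mem_zeroSum]; constructor
    · intro h i; exact congrFun h i
    · intro h; funext i; exact h i
  have hmem := mem_span_of_unitri W (L.map fun g => (g.pivot, g.vec)) (unitri_of_unitriB _ huni) ?_ ?_ ((hW x).2 hx)
  · refine Submodule.span_le.mpr ?_ hmem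
    rintro _ hg
    simp only [Set.mem_setOf_eq, List.map_map, List.mem_map, Function.comp] at hg
    obtain ⟨g, hgL, rfl⟩ := hg
    exact g.vec_mem_span (hok g hgL)
  · intro v hv
    simp only [List.map_map, List.mem_map, Function.comp] at hv
    obtain ⟨g, hgL, rfl⟩ := hv
    exact (hW _).2 (g.vec_mem_zeroSum (hok g hgL))
  · intro z hz hWz
    refine eq_zero_of_low (fun T hT => ?_) ((hW z).1 hWz)
    rcases hlow T (mem_allTypes _ T) with hp | hl
    · exact absurd (hz T (by simpa [List.map_map, Function.comp] using hp)) hT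
    · exact hl

/-! ### D. The engine: `decide` for `m = 1, …, 8` -/

/-- The certificate passes at `m = 1`. -/
theorem certB_cert_0 : certB (cert 0) = true := by decide +kernel

/-- The certificate passes at `m = 2`. -/
theorem certB_cert_1 : certB (cert 1) = true := by decide +kernel

/-- The certificate passes at `m = 3` (degree 6). -/
theorem certB_cert_2 : certB (cert 2) = true := by decide +kernel

/-- The certificate passes at `m = 4` (degree 8). -/
theorem certB_cert_3 : certB (cert 3) = true := by decide +kernel

/-- The certificate passes at `m = 5` (degree 10). -/
theorem certB_cert_4 : certB (cert 4) = true := by decide +kernel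

/-- The certificate passes at `m = 6` (degree 12). -/
theorem certB_cert_5 : certB (cert 5) = true := by decide +kernel

/-- The certificate passes at `m = 7` (degree 14): 64 pairs, 672 census faces, rank 121. -/
theorem certB_cert_6 : certB (cert 6) = true := by decide +kernel

/-- The three clauses of `certB` assembled. -/
theorem certB_of_parts {L : List (Gen n)} (h1 : L.all Gen.ok = true)
    (h2 : unitriB (L.map fun g => (g.pivot, g.vec)) = true)
    (h3 : ((allTypes (n + 1)).all fun T => decide (T ∈ L.map Gen.pivot) || lowB T) = true) : certB L = true := by
  unfold certB; rw [h1, h2, h3]; rfl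

/-- `m = 8`, clause 1: every generator is well-formed. -/
theorem certB_cert_7_ok : (cert 7).all Gen.ok = true := by decide +kernel

set_option maxRecDepth 4000 in
/-- `m = 8`, clause 2: the 248-generator system is unitriangular (the longest kernel computation of this file; the
248-entry list needs a recursion depth above the default 512 on the elaborator side). -/
theorem certB_cert_7_uni : unitriB ((cert 7).map fun g => (g.pivot, g.vec)) = true := by decide +kernel

/-- `m = 8`, clause 3: every non-pivot type is low. -/
theorem certB_cert_7_low : ((allTypes 8).all fun T => decide (T ∈ (cert 7).map Gen.pivot) || lowB T) = true := by
  decide +kernel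

/-- The certificate passes at `m = 8` (degree 16): 128 pairs, 1792 census faces, rank 248. -/
theorem certB_cert_7 : certB (cert 7) = true := certB_of_parts certB_cert_7_ok certB_cert_7_uni certB_cert_7_low

/-- **Lemma L at `m ≤ 8` by the certificate** — the lead's Smith table `m = 3 … 6` re-verified in the kernel by an
independent route (back-substitution along an explicit unitriangular system) and extended to `m = 7, 8`. -/
theorem index_one_le_eight : ∀ m, 1 ≤ m → m ≤ 8 → Submodule.span ℤ (pairs m ∪ faces m) = zeroSum m := by
  intro m h1 h8
  interval_cases m
  · exact span_eq_zeroSum_of_certB (cert 0) certB_cert_0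
  · exact span_eq_zeroSum_of_certB (cert 1) certB_cert_1
  · exact span_eq_zeroSum_of_certB (cert 2) certB_cert_2
  · exact span_eq_zeroSum_of_certB (cert 3) certB_cert_3
  · exact span_eq_zeroSum_of_certB (cert 4) certB_cert_4
  · exact span_eq_zeroSum_of_certB (cert 5) certB_cert_5
  · exact span_eq_zeroSum_of_certB (cert 6) certB_cert_6
  · exact span_eq_zeroSum_of_certB (cert 7) certB_cert_7

end HodgeRepro.Night3.Engine
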